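import Summits.ABC.FunctionField.TransferSheet
import Literature.NumberTheory.EllipticCurves.SilvermanHeightLogMaxProofs
import Literature.NumberTheory.EllipticCurves.ModularCurveNeronLatticeProofs
import Literature.NumberTheory.EllipticCurves.ModularCurveManinSemistableCoprimeFormProofs
import Literature.NumberTheory.EllipticCurves.SzpiroOfAbcProofs
import Literature.NumberTheory.EllipticCurves.SzpiroBGEquivalenceProofs
import Literature.NumberTheory.EllipticCurves.GlobalMinimalModelProofs
import HarnessLib

/-!
# Cell abc-ff — transfer sheet, STRENGTH certificates for rows CF-1 / CF-2 (kernel, sorry-free)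

`Summits/ABC/FunctionField/TransferSheetStrength.lean` — theorems only, about the requirement
statements of `Summits/ABC/FunctionField/TransferSheet.lean`. Kernel certificates written by the
cell's referee B (abc-ff-ref-2, `HOME/ref-2/RefB_CF1.lean`, farm rc 0) and landed here by the typer
with the names of the sheet; the mathematics is Silverman 1986 (Prop. 2.1 / Cor. 2.3, two-sided
comparison `C₀ ≤ log max(|Δ_min|, |c₄|³) − 12 h_F ≤ 6 log(1 + log max) + C₁`, PROVED in the tree as
`silverman1986_log_max_sub_height_holds`) and Bombieri–Gubler Thm. 12.5.12 (abc ⟺ generalized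
Szpiro, PROVED in the tree as `abcLe_iff_generalizedSzpiroBG_holds`). HONESTY: abc is not proved by
any of this — the file proves that the requirement `RKS` is EQUIVALENT to abc (a restatement, census
value nil as an opening, exact as a dictionary row), that `RKSPolar lam` gives generalized poly-Szpiro
with every exponent `6 + lam + ε` («NOT abc — POLY-SZPIRO»), and that abc gives `RKSPolar lam` for
every `lam > 0` (sandwich `abc ⟹ R_KSλ ⟹ POLY-SZPIRO(6+λ)`).

* `rks_iff_generalizedSzpiroBG`, `rks_iff_abc` — grade (i) of row CF-1: `R_KS ⟺ ABC`.
* `genPolySzpiroWith_of_heightBound`, `genPolySzpiroWith_of_rksPolar` — STRENGTH cell of CF-2.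
* `rksPolar_of_abc` — CF-2 is implied by abc for `lam > 0` (with `not_rksPolar_zero` of the sheet:
  the `ε` is load-bearing, barrier `Literature.Barriers.ABC.SzpiroEpsilonCannotBeDropped`).
-/

noncomputable section

open WeierstrassCurve NumberField
open Literature.NumberTheory.EllipticCurves Literature.NumberTheory.EllipticCurves.ModularForms
open Literature.NumberTheory.DiophantineGeometry

namespace Summit.ABC.FunctionField

/-! ### Elementary real analysis: `6 log(1 + x) ≤ η x + B(η)` -/

/-- For every `η > 0` there is `B` with `6 log(1 + x) ≤ η x + B` for all `x ≥ 0`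
(from `log y ≤ y − 1`). [folklore] -/
theorem six_log_one_add_le (η : ℝ) (hη : 0 < η) :
    ∃ B : ℝ, ∀ x : ℝ, 0 ≤ x → 6 * Real.log (1 + x) ≤ η * x + B := by
  refine ⟨η - 6 - 6 * Real.log (η / 6), fun x hx => ?_⟩
  have ht : 0 < η / 6 := by positivity
  have h1x : 0 < 1 + x := by linarith
  have hprod : 0 < η / 6 * (1 + x) := mul_pos ht h1x
  have hlog : Real.log (η / 6 * (1 + x)) = Real.log (η / 6) + Real.log (1 + x) :=
    Real.log_mul ht.ne' h1x.ne'
  have hle : Real.log (η / 6 * (1 + x)) ≤ η / 6 * (1 + x) - 1 := Real.log_le_sub_one_of_pos hprod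
  rw [hlog] at hle
  nlinarith

/-! ### Silverman's two-sided comparison, read through `WeierstrassCurve.faltingsHeight` -/

/-- Silverman 1986 (tree: `silverman1986_log_max_sub_height_holds`) read through
`faltingsHeight_eq_neg_half_log_covolume` and the existence of a Néron period pair
(`exists_isNeronLatticeOf_holds`): for a globally minimal elliptic `W/ℚ`,
`C₀ ≤ log max(|Δ_W|, |c₄|³) − 12 h_F(W) ≤ 6 log(1 + log max) + C₁` with absolute `C₀, C₁`.
[cite: Silverman1986, Prop. 2.1 and Cor. 2.3] -/
theorem silverman_two_sided :
    ∃ C₀ C₁ : ℝ, ∀ (W : WeierstrassCurve ℚ) [W.IsElliptic] [W.IsGloballyMinimal],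
      C₀ ≤ Real.log ((max |W.Δ| (|W.c₄| ^ 3) : ℚ) : ℝ) - 12 * W.faltingsHeight ∧
      Real.log ((max |W.Δ| (|W.c₄| ^ 3) : ℚ) : ℝ) - 12 * W.faltingsHeight ≤
        6 * Real.log (1 + Real.log ((max |W.Δ| (|W.c₄| ^ 3) : ℚ) : ℝ)) + C₁ := by
  obtain ⟨C₀, C₁, hS⟩ := silverman1986_log_max_sub_height_holds
  refine ⟨C₀, C₁, fun W _ _ => ?_⟩
  obtain ⟨L, hL⟩ := exists_isNeronLatticeOf_holds (W.baseChange ℂ)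
  have h12 : W.faltingsHeight = neronLatticeHeight L := by
    rw [W.faltingsHeight_eq_neg_half_log_covolume hL, neronLatticeHeight]
  rw [h12]
  exact hS W L hL

/-! ### A height bound `12 h_F ≤ K log N + C` gives generalized poly-Szpiro with every `K + ε` -/

/-- **STRENGTH cell of CF-2 (kernel):** a height bound `12 h_F(E) ≤ K log N_E + C` for all `E/ℚ`
with `K > 0` gives `GenPolySzpiroWith (K + ε)` for every `ε > 0` — the `j`-part `|c₄|³` included
(Silverman's upper comparison `6 log(1 + log M)` is absorbed into `ε log N`). With `K = 6 + λ` this is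
`R_KSλ ⟹` generalized POLY-SZPIRO(`6 + λ + ε`), hence POLY-abc(`1 + (λ + ε)/6`) through the Frey
curve («NOT abc»); with `K = 6 + ε/2` it is the abc-strength direction of `rks_iff_abc`. [folklore] -/
theorem genPolySzpiroWith_of_heightBound {K : ℝ} (hK : 0 < K)
    (h : ∃ C : ℝ, ∀ (W : WeierstrassCurve ℚ) [W.IsElliptic],
      12 * W.faltingsHeight ≤ K * Real.log (W.conductorNorm ℤ : ℝ) + C)
    (ε : ℝ) (hε : 0 < ε) : GenPolySzpiroWith (K + ε) := by
  set η : ℝ := ε / (K + ε) with hη_def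
  have hη : 0 < η := by positivity
  have hη1 : η < 1 := by
    rw [hη_def, div_lt_one (by positivity)]; linarith
  have hkey : (1 - η) * (K + ε) = K := by
    rw [hη_def]; field_simp; ring
  obtain ⟨C, hC⟩ := h
  obtain ⟨C₀, C₁, hS⟩ := silverman_two_sided
  obtain ⟨B, hB⟩ := six_log_one_add_le η hη
  refine ⟨Real.exp ((C + C₁ + B) / (1 - η)), fun W₀ hell hmin => ?_⟩
  set W : WeierstrassCurve ℚ := W₀.baseChange ℚ with hW_def
  haveI := hell
  haveI : W.IsGloballyMinimal := isGloballyMinimal_of_forall_isMinimalAt_int W hmin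
  set M : ℝ := ((max |W.Δ| (|W.c₄| ^ 3) : ℚ) : ℝ) with hM_def
  have hM1 : 1 ≤ M := one_le_max_abs_Δ_c4 W
  have hMpos : 0 < M := lt_of_lt_of_le one_pos hM1
  have hlogM : 0 ≤ Real.log M := Real.log_nonneg hM1
  have hNpos : 0 < (W.conductorNorm ℤ : ℝ) := by exact_mod_cast W.conductorNorm_pos_holds
  have hN1 : (1 : ℝ) ≤ (W.conductorNorm ℤ : ℝ) := by exact_mod_cast W.conductorNorm_pos_holds
  have hlogN : 0 ≤ Real.log (W.conductorNorm ℤ : ℝ) := Real.log_nonneg hN1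
  have hup := (hS W).2
  have hCW := hC W
  have hBM := hB (Real.log M) hlogM
  have h1 : (1 - η) * Real.log M ≤ K * Real.log (W.conductorNorm ℤ : ℝ) + (C + C₁ + B) := by
    nlinarith
  have h2 : Real.log M ≤ (K + ε) * Real.log (W.conductorNorm ℤ : ℝ) + (C + C₁ + B) / (1 - η) := by
    have h1η : 0 < 1 - η := by linarith
    rw [← hkey] at h1
    have : Real.log M ≤ ((1 - η) * (K + ε) * Real.log (W.conductorNorm ℤ : ℝ) + (C + C₁ + B)) /
        (1 - η) := by
      rw [le_div_iff₀ h1η]; linarith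
    calc Real.log M ≤ _ := this
      _ = (K + ε) * Real.log (W.conductorNorm ℤ : ℝ) + (C + C₁ + B) / (1 - η) := by
          field_simp
  have h3 : M ≤ Real.exp ((C + C₁ + B) / (1 - η)) * (W.conductorNorm ℤ : ℝ) ^ (K + ε) := by
    have := Real.exp_le_exp.mpr h2
    rw [Real.exp_log hMpos, Real.exp_add, mul_comm] at this
    rwa [Real.rpow_def_of_pos hNpos, mul_comm (Real.log _)]
  have hcast : ((max |W₀.Δ| (|W₀.c₄| ^ 3) : ℤ) : ℝ) = M := by
    have hΔ : W.Δ = (W₀.Δ : ℚ) := by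
      rw [hW_def, baseChange, map_Δ, algebraMap_int_eq, eq_intCast]
    have hc4 : W.c₄ = (W₀.c₄ : ℚ) := by
      rw [hW_def, baseChange, map_c₄, algebraMap_int_eq, eq_intCast]
    rw [hM_def, hΔ, hc4]
    push_cast
    rfl
  rw [hcast]
  exact h3

/-- `R_KSλ ⟹` generalized poly-Szpiro with every exponent `6 + λ + ε` (`λ > −6`).
«NOT abc — POLY-SZPIRO(6 + λ + ε)», `j`-part included. [folklore] -/
theorem genPolySzpiroWith_of_rksPolar {lam : ℝ} (hlam : -6 < lam) (h : RKSPolar lam)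
    (ε : ℝ) (hε : 0 < ε) : GenPolySzpiroWith (6 + lam + ε) :=
  genPolySzpiroWith_of_heightBound (K := 6 + lam) (by linarith) h ε hε

/-! ### Grade (i) of row CF-1: `R_KS ⟺` generalized Szpiro `⟺ ABC` -/

/-- `R_KS ⟹` the generalized Szpiro conjecture of Bombieri–Gubler 12.5.11 (ask `R_KS` for `ε/2`,
absorb Silverman's `6 log(1 + log M)` into the other `ε/2`). [folklore] -/
theorem generalizedSzpiroBG_of_rks (h : RKS) : GeneralizedSzpiroConjectureBG := by
  intro ε hε
  have h' : ∃ C : ℝ, ∀ (W : WeierstrassCurve ℚ) [W.IsElliptic],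
      12 * W.faltingsHeight ≤ (6 + ε / 2) * Real.log (W.conductorNorm ℤ : ℝ) + C :=
    h (ε / 2) (by positivity)
  have := genPolySzpiroWith_of_heightBound (K := 6 + ε / 2) (by positivity) h' (ε / 2) (by positivity)
  rw [show 6 + ε / 2 + ε / 2 = 6 + ε by ring] at this
  exact this

/-- The generalized Szpiro conjecture (`⟺ abc`) `⟹ R_KS` (Silverman's LOWER comparison
`C₀ ≤ log max − 12 h_F` on a global minimal model, `hasGlobalMinimalModel_rat_holds`; the height and
the conductor are model-independent: `faltingsHeight_smul`, `conductorNorm_smul_rat`). [folklore] -/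
theorem rks_of_generalizedSzpiroBG (h : GeneralizedSzpiroConjectureBG) : RKS := by
  intro ε hε
  obtain ⟨C, hC⟩ := h ε hε
  obtain ⟨C₀, C₁, hS⟩ := silverman_two_sided
  refine ⟨Real.log (max C 1) - C₀, fun W _ => ?_⟩
  obtain ⟨Cv, hmin⟩ := hasGlobalMinimalModel_rat_holds W
  haveI := hmin
  rw [← faltingsHeight_smul W Cv, ← conductorNorm_smul_rat W Cv]
  set W' : WeierstrassCurve ℚ := Cv • W with hW'_def
  set M : ℝ := ((max |W'.Δ| (|W'.c₄| ^ 3) : ℚ) : ℝ) with hM_def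
  have hM1 : 1 ≤ M := one_le_max_abs_Δ_c4 W'
  have hMpos : 0 < M := lt_of_lt_of_le one_pos hM1
  have hNpos : 0 < (W'.conductorNorm ℤ : ℝ) := by exact_mod_cast W'.conductorNorm_pos_holds
  have hlow := (hS W').1
  -- generalized Szpiro for the integral model of `W'`
  have e : (integralModelInt W').baseChange ℚ = W' := baseChange_integralModelInt W'
  have hGS := hC (integralModelInt W') (by rw [e]; infer_instance)
    (fun v => by rw [e]; exact IsGloballyMinimal.isMinimalAt_int W' v)
  rw [e] at hGS
  have hcast : ((max |(integralModelInt W').Δ| (|(integralModelInt W').c₄| ^ 3) : ℤ) : ℝ) = M := by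
    have hΔ : W'.Δ = ((integralModelInt W').Δ : ℚ) := by
      rw [← cast_minimalDiscriminantInt W']; rfl
    have hc4 : W'.c₄ = ((integralModelInt W').c₄ : ℚ) := (cast_integralModelInt_c₄ W').symm
    rw [hM_def, hΔ, hc4]
    push_cast
    rfl
  rw [hcast] at hGS
  have hC1 : 0 < max C 1 := lt_of_lt_of_le one_pos (le_max_right _ _)
  have hGS' : M ≤ max C 1 * (W'.conductorNorm ℤ : ℝ) ^ (6 + ε) :=
    hGS.trans (mul_le_mul_of_nonneg_right (le_max_left _ _) (Real.rpow_nonneg hNpos.le _))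
  have hlogM : Real.log M ≤ Real.log (max C 1) + (6 + ε) * Real.log (W'.conductorNorm ℤ : ℝ) := by
    have := Real.log_le_log hMpos hGS'
    rwa [Real.log_mul hC1.ne' (Real.rpow_pos_of_pos hNpos _).ne', Real.log_rpow hNpos] at this
  linarith

/-- **Row CF-1, grade (i): `R_KS ⟺` generalized Szpiro (Bombieri–Gubler 12.5.11).** [folklore] -/
theorem rks_iff_generalizedSzpiroBG : RKS ↔ GeneralizedSzpiroConjectureBG :=
  ⟨generalizedSzpiroBG_of_rks, rks_of_generalizedSzpiroBG⟩

/-- The tree's Bombieri–Gubler equivalence (`abcLe_iff_generalizedSzpiroBG_holds`, Thm. 12.5.12)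
composed with the sheet's `abc_iff_forall_polyAbcWith` (`<`/`0 < C` versus `≤`):
generalized Szpiro `⟺ ABC`. [cite: BombieriGubler2006, Thm. 12.5.12] -/
theorem generalizedSzpiroBG_iff_abc : GeneralizedSzpiroConjectureBG ↔ _root_.ABC :=
  abcLe_iff_generalizedSzpiroBG_holds.symm.trans abc_iff_forall_polyAbcWith.symm

/-- **Row CF-1, grade (i): `R_KS ⟺ ABC`.** The replacement statement for the Kodaira–Spencer step is a
RESTATEMENT of the summit: as an opening its census value is nil; as a dictionary row it pins exactly
what an arithmetic Kodaira–Spencer inequality must output. abc is NOT proved by this. [folklore] -/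
theorem rks_iff_abc : RKS ↔ _root_.ABC :=
  rks_iff_generalizedSzpiroBG.trans generalizedSzpiroBG_iff_abc

/-- `ABC ⟹ R_KS`. [folklore] -/
theorem rks_of_abc (h : _root_.ABC) : RKS := rks_iff_abc.mpr h

/-- `R_KS ⟹ ABC` (the PATH of chain (a) to the summit itself, not only to Szpiro `6 + ε`). [folklore] -/
theorem abc_of_rks (h : RKS) : _root_.ABC := rks_iff_abc.mp h

/-- **Sandwich for row CF-2:** `ABC ⟹ R_KSλ` for every `λ > 0` (and `R_KSλ ⟹ POLY-SZPIRO(6 + λ)`,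
`polySzpiroWith_of_rksPolar`); `λ = 0` is false (`not_rksPolar_zero`). So CF-2 is WEAKER than abc
exactly by fixing the loss. [folklore] -/
theorem rksPolar_of_abc (h : _root_.ABC) {lam : ℝ} (hlam : 0 < lam) : RKSPolar lam :=
  (rks_of_abc h) lam hlam

end Summit.ABC.FunctionField

end
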